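import Mathlib
import Summits.MatrixMultiplication.MatrixMultiplication.Theorems.SnSubsetDichotomyHyperoctahedralThresholdStubRichDescent
import Summits.MatrixMultiplication.MatrixMultiplication.Theorems.SnSubsetDichotomyHyperoctahedralSubsetsDisjointWalks
import Summits.MatrixMultiplication.MatrixMultiplication.Theorems.SnSubsetDichotomyHyperoctahedralSubsetsPairUp
import Summits.MatrixMultiplication.MatrixMultiplication.Theorems.SnSubsetDichotomyHyperoctahedralThresholdStubCycleGadget

set_option linter.dupNamespace false

/-!
# Polynomially rich words are fatal (`stub_richWordsPoly`)

Crux `HyperoctahedralSubsets` (stmt-MatrixMultiplication-8305), line `spherical-rank-sieve`, lead c6.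

The skeleton's `RichWords` (lead -1 / c3) turns a cyclically non-backtracking colour word of length
`ℓ = k + 2` with at least `(2G + |R| + 1)·(2ℓ)^(2⌊log₂ ℓ⌋ + 2)` closed walks into `G` support-disjoint
commuting local triples avoiding `R`.  The quasi-polynomial factor is inherited from the REGISTERED
statement of the twin crux's `stub_richDescent`; but the landed PROOF of that stub
(`…Theorems.HyperoctahedralThreshold.stub_richDescent`, a direct dichotomy on minimal repetitions, no
recursion) only uses the square `ℓ²` of the length.  This file records the polynomial form:

* `RichWordsPoly.richDescent_sq` — `stub_richDescent` with hypothesis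
  `ℓ² (2ℓM + 2ℓ² + 2) ≤ |W|` (same proof, reusing the tree lemmas `RichDescent.window`,
  `RichDescent.bad_mem`, `RichDescent.count_good`);
* `stub_richWordsPoly` — a cyclically non-backtracking word of length `ℓ` with at least
  `16 ℓ⁴ (2G + |R| + 1)` closed walks yields `G` support-disjoint commuting local triples whose supports
  avoid `R` (via `richDescent_sq`, `stub_disjointWalks` p97993, `stub_pairUp` p97778 and the twin's
  clean-cycle gadget `stub_cycleGadget`).

Consequence for the matching lemma (L′): a counterexample host must have FEWER than `48⌈c√n⌉ℓ⁴`
closed walks on every cyclically reduced word of every length `ℓ` — polynomially bounded fixity of all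
short words, and in particular no relator of its monodromy group shorter than `≈ n^{1/8}` (lead c6 memo
`Cruxes/HyperoctahedralSubsets/LeadC6-Monodromy.md`).
-/

namespace Summit.MatrixMultiplication.MatrixMultiplication.Theorems.HyperoctahedralSubsets

open Summit.MatrixMultiplication.MatrixMultiplication.Theorems.HyperoctahedralThreshold

namespace RichWordsPoly

/-- **Rich descent with a square loss.**  For three fixed-point-free involutions `μ 0, μ 1, μ 2` of
`Fin n`, a cyclically reduced colour word `col` of length `k + 2` and a finset `W` of closed walks reading
`col` with `(k + 2)² (2 (k + 2) M + 2 (k + 2)² + 2) ≤ |W|`, some cyclically reduced word `col'` of length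
`k' + 2 ≤ k + 2` has more than `(k' + 2) M + (k' + 2)²` SIMPLE closed walks.  Proof = the tree's
`stub_richDescent` verbatim without its final weakening `(k+2)² ≤ (k+2)^(2 log₂ (k+2))`. [folklore] -/
theorem richDescent_sq (n k M : ℕ) (μ : Fin 3 → Equiv.Perm (Fin n)) (hinv : ∀ c, μ c * μ c = 1)
    (hfpf : ∀ c v, μ c v ≠ v) (col : Fin (k + 2) → Fin 3) (hcol : ∀ i, col i ≠ col (i + 1))
    (W : Finset (Fin (k + 2) → Fin n)) (hW : ∀ p ∈ W, ∀ i, μ (col i) (p i) = p (i + 1))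
    (hrich : (k + 2) ^ 2 * (2 * (k + 2) * M + 2 * (k + 2) ^ 2 + 2) ≤ W.card) :
    ∃ k' ≤ k, ∃ (col' : Fin (k' + 2) → Fin 3) (P : Finset (Fin (k' + 2) → Fin n)),
      (∀ i, col' i ≠ col' (i + 1)) ∧ (∀ p ∈ P, Function.Injective p ∧ ∀ i, μ (col' i) (p i) = p (i + 1)) ∧
      (k' + 2) * M + (k' + 2) ^ 2 < P.card := by
  choose col' P B hPB hne hP hB using fun a d => RichDescent.window μ col hcol W hW a d
  by_cases hbig : ∃ a d, d ≤ k ∧ (d + 2) * M + (d + 2) ^ 2 < (P a d).card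
  · obtain ⟨a, d, hd, hcard⟩ := hbig
    exact ⟨d, hd, col' a d, P a d, hne a d (Finset.card_pos.mp (by omega)), hP a d, hcard⟩
  · refine ⟨k, le_rfl, col, W.filter fun p => Function.Injective p, hcol, ?_, ?_⟩
    · intro p hp
      obtain ⟨hpW, hinj⟩ := Finset.mem_filter.mp hp
      exact ⟨hinj, hW p hpW⟩
    · -- every window carries few simple closed sub-walks
      have hsmall : ∀ a d, d ≤ k → (B a d).card ≤ (k + 2) * M + (k + 2) ^ 2 := by
        intro a d hd
        have h1 : (P a d).card ≤ (d + 2) * M + (d + 2) ^ 2 := by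
          by_contra h
          exact hbig ⟨a, d, hd, not_le.mp h⟩
        have hd2 : d + 2 ≤ k + 2 := by omega
        calc (B a d).card = (P a d).card := (hPB a d).symm
          _ ≤ (d + 2) * M + (d + 2) ^ 2 := h1
          _ ≤ (k + 2) * M + (k + 2) ^ 2 :=
            Nat.add_le_add (Nat.mul_le_mul_right _ hd2) (Nat.pow_le_pow_left hd2 2)
      -- hence few walks of `W` are non-simple
      have hbad : (W.filter fun p => ¬ Function.Injective p).card ≤
          (k + 2) * (k + 1) * ((k + 2) * M + (k + 2) ^ 2) := by
        calc (W.filter fun p => ¬ Function.Injective p).card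
            ≤ ((Finset.range (k + 2) ×ˢ Finset.range (k + 1)).biUnion
                fun x => B x.1 x.2).card := by
              refine Finset.card_le_card fun p hp => ?_
              obtain ⟨hpW, hpbad⟩ := Finset.mem_filter.mp hp
              obtain ⟨a, d, had, h1, h2, h3⟩ :=
                RichDescent.bad_mem μ hinv hfpf col hcol p (hW p hpW) hpbad
              exact Finset.mem_biUnion.mpr ⟨(a, d), Finset.mem_product.mpr
                ⟨Finset.mem_range.mpr (by omega), Finset.mem_range.mpr (by omega)⟩,
                hB a d p hpW h1 h2 h3⟩
          _ ≤ ∑ x ∈ Finset.range (k + 2) ×ˢ Finset.range (k + 1), (B x.1 x.2).card :=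
              Finset.card_biUnion_le
          _ ≤ ∑ _x ∈ Finset.range (k + 2) ×ˢ Finset.range (k + 1),
                ((k + 2) * M + (k + 2) ^ 2) :=
              Finset.sum_le_sum fun x hx => hsmall x.1 x.2 (by
                have h := (Finset.mem_product.mp hx).2
                rw [Finset.mem_range] at h
                omega)
          _ = (k + 2) * (k + 1) * ((k + 2) * M + (k + 2) ^ 2) := by
              rw [Finset.sum_const, Finset.card_product, Finset.card_range, Finset.card_range,
                smul_eq_mul]
      have hsplit : (W.filter fun p => Function.Injective p).card +
          (W.filter fun p => ¬ Function.Injective p).card = W.card :=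
        Finset.card_filter_add_card_filter_not _
      exact RichDescent.count_good k M W.card _ _ hrich hbad hsplit

end RichWordsPoly

/-- **Polynomially rich words are fatal** (registered stub `stub_richWordsPoly` of crux
stmt-MatrixMultiplication-8305, line `spherical-rank-sieve`, lead c6).  For three fixed-point-free
involutions `μ 0, μ 1, μ 2` of `Fin n`, a cyclically non-backtracking colour word `col` of length `k + 2`
with at least `16 (k + 2)⁴ (2G + |R| + 1)` closed walks, and any finset `R` of forbidden points, there are
`G` commuting local triples `(a_j, b_j)` (commuting involutions, not both trivial, `a_j ∈ C(μ 0)`,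
`b_j ∈ C(μ 1)`, `a_j b_j ∈ C(μ 2)`) with pairwise disjoint supports, all avoiding `R`.  Chain:
`RichWordsPoly.richDescent_sq` (simple closed walks of a sub-word) → `stub_disjointWalks` (p97993, a
point-disjoint sub-family avoiding `R`) → `stub_pairUp` (p97778) with the twin crux's clean-cycle gadget
`stub_cycleGadget`.  The skeleton's `richWords_holds` is the same chain with the quasi-polynomial
threshold `(2G + |R| + 1)(2(k+2))^(2⌊log₂(k+2)⌋+2)`. [folklore] -/
theorem stub_richWordsPoly : ∀ (n k G : ℕ) (μ : Fin 3 → Equiv.Perm (Fin n)) (col : Fin (k + 2) → Fin 3) (R : Finset (Fin n)), (∀ c, μ c * μ c = 1) → (∀ c v, μ c v ≠ v) → (∀ i, col i ≠ col (i + 1)) → 16 * (k + 2) ^ 4 * (2 * G + R.card + 1) ≤ (Finset.univ.filter (fun p : Fin (k + 2) → Fin n => ∀ i, μ (col i) (p i) = p (i + 1))).card → ∃ (a b : Fin G → Equiv.Perm (Fin n)), (∀ j, a j * a j = 1 ∧ b j * b j = 1 ∧ a j * b j = b j * a j ∧ (a j ≠ 1 ∨ b j ≠ 1) ∧ a j *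 μ 0 = μ 0 * a j ∧ b j * μ 1 = μ 1 * b j ∧ a j * b j * μ 2 = μ 2 * (a j * b j)) ∧ (∀ j j' : Fin G, j ≠ j' → ∀ v, (a j v ≠ v ∨ b j v ≠ v) → a j' v = v ∧ b j' v = v) ∧ (∀ j v, (a j v ≠ v ∨ b j v ≠ v) → v ∉ R) := by
  intro n k G μ col R hinv hfpf hcol hbig
  classical
  set W : Finset (Fin (k + 2) → Fin n) :=
    Finset.univ.filter (fun p : Fin (k + 2) → Fin n => ∀ i, μ (col i) (p i) = p (i + 1)) with hW_def
  have hW : ∀ p ∈ W, ∀ i, μ (col i) (p i) = p (i + 1) := fun p hp => (Finset.mem_filter.1 hp).2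
  set M : ℕ := 2 * G * (k + 3) + R.card with hM_def
  -- the polynomial richness threshold dominates the descent's threshold at this `M`
  have hrich : (k + 2) ^ 2 * (2 * (k + 2) * M + 2 * (k + 2) ^ 2 + 2) ≤ W.card := by
    refine le_trans ?_ hbig
    have hsmall : 2 * (k + 2) * M + 2 * (k + 2) ^ 2 + 2 ≤ 16 * (k + 2) ^ 2 * (2 * G + R.card + 1) := by
      have h1 : 2 * (k + 2) * M = 4 * G * ((k + 2) * (k + 3)) + 2 * (k + 2) * R.card := by
        rw [hM_def]; ring
      have h2 : (k + 2) * (k + 3) ≤ 2 * (k + 2) ^ 2 := by nlinarith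
      have h3 : 2 * (k + 2) * R.card ≤ 16 * (k + 2) ^ 2 * R.card := by nlinarith
      have h4 : 2 * (k + 2) ^ 2 + 2 ≤ 16 * (k + 2) ^ 2 := by nlinarith
      nlinarith [h1, h2, h3, h4]
    calc (k + 2) ^ 2 * (2 * (k + 2) * M + 2 * (k + 2) ^ 2 + 2)
        ≤ (k + 2) ^ 2 * (16 * (k + 2) ^ 2 * (2 * G + R.card + 1)) := Nat.mul_le_mul_left _ hsmall
      _ = 16 * (k + 2) ^ 4 * (2 * G + R.card + 1) := by ring
  obtain ⟨k', hk', col', P, hcol', hP, hPcard⟩ :=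
    RichWordsPoly.richDescent_sq n k M μ hinv hfpf col hcol W hW hrich
  have hP' : ∀ p ∈ P, (∀ i, μ (col' i) (p i) = p (i + 1)) ∧ Function.Injective p :=
    fun p hp => ⟨(hP p hp).2, (hP p hp).1⟩
  obtain ⟨S', hS'P, hScard, hdisj, havoid⟩ := stub_disjointWalks n k' μ col' P R hP'
  have hS' : ∀ p ∈ S', (∀ i, μ (col' i) (p i) = p (i + 1)) ∧ Function.Injective p :=
    fun p hp => hP' p (hS'P hp)
  -- arithmetic: `2G ≤ |S'|`
  have h2G : 2 * G ≤ S'.card := by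
    have hk3 : (k' + 2) * (k' + 2) + 1 ≤ (k' + 2) * (k + 3) := by nlinarith
    have hM1 : 2 * G * ((k' + 2) * (k' + 2) + 1) + (k' + 2) * R.card ≤ (k' + 2) * M := by
      have : 2 * G * ((k' + 2) * (k' + 2) + 1) ≤ 2 * G * ((k' + 2) * (k + 3)) :=
        Nat.mul_le_mul_left _ hk3
      rw [hM_def]; nlinarith [this]
    have hlt : 2 * G * ((k' + 2) * (k' + 2) + 1) < S'.card * ((k' + 2) * (k' + 2) + 1) := by
      have := hPcard.trans_le hScard
      nlinarith [this, hM1]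
    have := lt_of_mul_lt_mul_right hlt
    omega
  obtain ⟨a, b, hgad, hfix, hsupp⟩ :=
    stub_pairUp n k' G μ col' S' hinv hcol' hS' hdisj h2G stub_cycleGadget
  refine ⟨a, b, hgad, hfix, fun j v hv => ?_⟩
  obtain ⟨p, hp, i, hpi⟩ := hsupp j v hv
  rw [← hpi]
  exact havoid p hp i

end Summit.MatrixMultiplication.MatrixMultiplication.Theorems.HyperoctahedralSubsets
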